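import Summits.QuantumFields.YangMills.Theorems.UnitScaleGibbsAxialGaugeCondSD
import Literature.MathematicalPhysics.QuantumFieldTheory.Balaban1983to89.T4PairDerivBridge
import HarnessLib

/-!
# The INTEGRATED EVENT SPLIT of `stub_linTest` (LINE 28 «GrossTransfer»), dressed side: a pointwise bound on the small-field event
# ⟹ `∫ dist₁(Ū^j(∂a))² ≤ C·Σ_α ∫ Y_α(V U)² + E + 4·μ{¬ small}` (crux `MeanDeviationL` stmt-QuantumFields-23083 ∕ `HistoryTailL` 19936)

Cell `ym3-torus` (YM ladder rung R3 = continuum SU(2) Yang–Mills on T³ — a RUNG, NOT the Clay problem: not d = 4, not infinite volume, not a mass gap);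
TWIN-WIDTH helper seat `ym-ust-19936-w8` g10; piece (INT) of w2-19936 g14's handoff recipe for the registered stub `stub_linTest` of LINE 28
(skeleton v2 `Cruxes/HistoryTailL/Lines/gross_transfer.lean` 5d16c6d70f019e13 on stmt-QuantumFields-23083, ★★OWNER RECORD 17x); `--supports
stmt-QuantumFields-23083 --as helper`; THEOREMS ONLY (0 `def`, 0 `sorry`, default heartbeats).

WHY.  `stub_linTest` ends with an INTEGRATED inequality
`∫ dist₁(Ū^j(∂a))² dμ_K ≤ C·Σ_α ∫ (actionDeriv ρ (u α) (V U))² dμ_K + C·γL^{−(K−j)} + 4·μ_K{¬ PlaqSmallOn (boxPlaqs lo hi) θ_K}`, `V U = U^{axialGauge U lo hi}`,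
whose CONTENT is a POINTWISE deterministic linearisation on the small-field event (w2's ✓LOC-A∕B∕C∕D, px10's ✓(K)(S)∕(X-KNIT), px5's ✓(LIN-ID), w5's ✓(D3♭)).
This file supplies the measure-theoretic plumbing ONCE, in the stub's own tokens, so the pen proves only the pointwise bound:
* §1 ★`dist1_plaqHol_iter_gaugeAct` — the block plaquette deviation is GAUGE INVARIANT: `dist₁((U^g)‾^k(∂a)) = dist₁(Ū^k(∂a))` for `k ≤ m + K`
  (lit ✓`T4Continuum.iter_gaugeAct` + ✓`T4ReTrLipUnitary.plaqHol_gaugeAct` + `dist1_conj`); in particular it may be READ ON THE DRESSED FIELD `V U`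
  (`dist1_plaqHol_iter_dressed`).
* §2 ★★`integral_le_of_onEvent_bound` — abstract: on a probability space, `0 ≤ f ≤ M` everywhere and `f ≤ g` on a measurable event `G` with `0 ≤ g` integrable
  ⟹ `∫ f ≤ ∫ g + M·μ.real Gᶜ` (no measurability of `f` needed).
* §3 ★★`integral_le_of_pointwise_dressed` — `SU(N)`, any probability measure, any sitewise family of test fields: the rows `U ↦ (actionDeriv ρ (u α) (V U))²` are
  bounded measurable (✓2b `continuous_actionDeriv` on the compact configuration space ∘ ✓(AX-DOCK) `measurable_gaugeAct_axialGauge`), hence integrable, and §2 gives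
  `∫ f ≤ C·Σ_α ∫ (actionDeriv ρ (u α) (V U))² + E + M·μ.real Gᶜ` from the pointwise bound on `G`.
* §4 ★★★`integral_dist1_sq_iter_le_of_pointwise` — IN THE STUB's CURRENCY (`gibbsK F ℰp γ K`, `γ ≥ 0`, `Averaging.iter (fun i' => BlockAveraging.blockAvg ℰp) j`,
  `dist₁ ≤ 2` on `SU(2)` ✓`dist1_le_two_specialUnitaryGroup`, event `{U | PlaqSmallOn (boxPlaqs lo hi) θ U}` ✓`measurableSet_plaqSmallOn`):
  pointwise on the event ⟹ the last three lines of `stub_linTest` verbatim (with `E` for `C·γL^{−(K−j)}` and `θ` free).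
HONEST SCOPE.  Plumbing; NOTHING of the pointwise linearisation ((G) flux components, (P2)(P3) cone centre, (S_test)), of `stub_linTest`, `stub_hessOnEvent`,
«ShallowFluxSecondMomentL», (Q), K1, `MeanDeviationL` 23083 ∕ 23133 ∕ 23134, `HistoryTailL`, the rung R3, d = 4, a continuum limit or a mass gap is proved here;
the Yang–Mills mass gap is NOT proved.

References: L. Gross, CMP 92 (1983) 137–162, Thm 2.2 [GrossCMP1983]; T. Bałaban, CMP 98 (1985) 17–51, (11) p.19 (gauge covariance of averaging) [Balaban1985Averaging].
-/

set_option autoImplicit false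

noncomputable section

open MeasureTheory Filter Topology
open scoped BigOperators
open Literature.MathematicalPhysics.QuantumFieldTheory.Balaban1983to89
open Literature.MathematicalPhysics.QuantumFieldTheory.Balaban1983to89.T3ContinuumYM3Torus
open Literature.MathematicalPhysics.QuantumFieldTheory.Balaban1983to89.T3UnitScaleTilt
open Literature.MathematicalPhysics.QuantumFieldTheory.Balaban1983to89.T3UnitLawDensityEML (ℰp measurableE_ℰp)
open Literature.MathematicalPhysics.QuantumFieldTheory.Balaban1983to89.T4AxialGaugeSmallField (axialGauge boxPlaqs castSite)
open Literature.MathematicalPhysics.QuantumFieldTheory.Balaban1983to89.T4AxialGaugeFixing (measurableSet_plaqSmallOn)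
open Literature.MathematicalPhysics.QuantumLattice (fundamentalRep continuous_fundamentalRep)
open Summit.QuantumFields.YangMills.Theorems.EquipartitionPinsProbe.TangentSteinFiniteBeta (exists_abs_le_of_continuous)
open Summit.QuantumFields.YangMills.Theorems.UnitScaleGibbsMGFSecondMoment (integrable_of_abs_le)
open Summit.QuantumFields.YangMills.Theorems.UnitScaleGibbsActionDerivativeSlotCalculus (actionDeriv continuous_actionDeriv)
open Summit.QuantumFields.YangMills.Theorems.UnitScaleGibbsAxialGaugeDocking (measurable_gaugeAct_axialGauge)

namespace Summit.QuantumFields.YangMills.Theorems.UnitScaleGibbsDressedEventSplit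

/-! ## §1 Gauge invariance of the block plaquette deviation -/

section Invariance

variable {P : Params} {G : Type*} [GaugeGroup G]

/-- ★ **THE BLOCK PLAQUETTE DEVIATION IS GAUGE INVARIANT**: `dist₁((U^g)‾^k(∂a)) = dist₁(Ū^k(∂a))` for every averaging family, every gauge transformation
`g` of the finest lattice and every `k ≤ m + K` (averaging is gauge COVARIANT, [Balaban1985Averaging] (11): `(U^g)‾ = Ū^{g∘emb}`, iterated by
✓`T4Continuum.iter_gaugeAct`; `U^u(∂p) = u(p₋)U(∂p)u(p₋)⁻¹`; `dist₁` is conjugation invariant). [cite: Balaban1985Averaging, (11) p.19] -/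
theorem dist1_plaqHol_iter_gaugeAct (av : ∀ j, Averaging P j G) (g : GaugeTransf P 0 G) {k : ℕ} (hk : k ≤ P.m + P.K)
    (U : GaugeField P 0 G) (a : Plaq P k) :
    dist1 (GaugeField.plaqHol (Averaging.iter av k (GaugeField.gaugeAct g U)) a) =
      dist1 (GaugeField.plaqHol (Averaging.iter av k U) a) := by
  rw [T4Continuum.iter_gaugeAct av g k hk U, T4ReTrLipUnitary.plaqHol_gaugeAct, GaugeGroup.dist1_conj]

/-- The same READ ON A DRESSED FIELD `V U = U^{g U}` (any dressing `g : GaugeField → GaugeTransf`, e.g. `axialGauge · lo hi`):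
`dist₁(V̄^k(∂a)) = dist₁(Ū^k(∂a))`. [cite: Balaban1985Averaging, (11) p.19] -/
theorem dist1_plaqHol_iter_dressed (av : ∀ j, Averaging P j G) (g : GaugeField P 0 G → GaugeTransf P 0 G) {k : ℕ}
    (hk : k ≤ P.m + P.K) (U : GaugeField P 0 G) (a : Plaq P k) :
    dist1 (GaugeField.plaqHol (Averaging.iter av k (GaugeField.gaugeAct (g U) U)) a) =
      dist1 (GaugeField.plaqHol (Averaging.iter av k U) a) :=
  dist1_plaqHol_iter_gaugeAct av (g U) hk U a

end Invariance

/-! ## §2 The abstract integrated event split -/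

section Abstract

variable {Ω : Type*} [MeasurableSpace Ω] (μ : Measure Ω) [IsProbabilityMeasure μ]

/-- ★★ **THE INTEGRATED EVENT SPLIT** (abstract): if `0 ≤ f ≤ M` everywhere, `G` is a measurable event, `0 ≤ g` is integrable and `f ≤ g` ON `G`, then
`∫ f dμ ≤ ∫ g dμ + M·μ(Gᶜ)` — pointwise `f ≤ g + M·𝟙_{Gᶜ}` (on `G`: `f ≤ g`; off `G`: `f ≤ M ≤ g + M`); NO measurability of `f` is needed
(`integral_mono_of_nonneg`). [cite: GrossCMP1983, Thm 2.2] -/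
theorem integral_le_of_onEvent_bound {f g : Ω → ℝ} {M : ℝ} (hf0 : ∀ ω, 0 ≤ f ω) (hfM : ∀ ω, f ω ≤ M)
    {G : Set Ω} (hG : MeasurableSet G) (hg0 : ∀ ω, 0 ≤ g ω) (hgi : Integrable g μ) (hfg : ∀ ω ∈ G, f ω ≤ g ω) :
    ∫ ω, f ω ∂μ ≤ ∫ ω, g ω ∂μ + M * μ.real Gᶜ := by
  classical
  have hM : ∀ ω ∈ Gᶜ, (0 : ℝ) ≤ M := fun ω _ => (hf0 ω).trans (hfM ω)
  -- the majorant `h = g + M·𝟙_{Gᶜ}`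
  set h : Ω → ℝ := fun ω => g ω + M * Gᶜ.indicator (fun _ => (1 : ℝ)) ω with hh
  have hind : Integrable (fun ω => Gᶜ.indicator (fun _ => (1 : ℝ)) ω) μ :=
    (integrable_const (1 : ℝ)).indicator hG.compl
  have hhi : Integrable h μ := hgi.add (hind.const_mul M)
  have hfh : ∀ ω, f ω ≤ h ω := fun ω => by
    by_cases hω : ω ∈ G
    · have : ω ∉ Gᶜ := fun h' => h' hω
      simp only [hh, Set.indicator_of_notMem this, mul_zero, add_zero]
      exact hfg ω hω
    · have hω' : ω ∈ Gᶜ := hω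
      simp only [hh, Set.indicator_of_mem hω', mul_one]
      linarith [hfM ω, hg0 ω]
  calc ∫ ω, f ω ∂μ ≤ ∫ ω, h ω ∂μ :=
        integral_mono_of_nonneg (ae_of_all _ hf0) hhi (ae_of_all _ hfh)
    _ = ∫ ω, g ω ∂μ + M * ∫ ω, Gᶜ.indicator (fun _ => (1 : ℝ)) ω ∂μ := by
        rw [hh, integral_add hgi (hind.const_mul M), integral_const_mul]
    _ = ∫ ω, g ω ∂μ + M * μ.real Gᶜ := by
        rw [integral_indicator hG.compl, setIntegral_const, smul_eq_mul, mul_one]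

end Abstract

/-! ## §3 The dressed rows are integrable; the split for `SU(N)` -/

section SpecialUnitary

variable {N : ℕ} [NeZero N] {P : Params}

/-- The dressed Schwinger–Dyson observable `U ↦ actionDeriv ρ u (U^{axialGauge U lo hi})` of `SU(N)` is MEASURABLE and BOUNDED (continuity of
`actionDeriv` on the compact configuration space — px17's slot calculus — composed with the measurable dressing of (AX-DOCK)). [cite: GrossCMP1983, Thm 2.2] -/
theorem measurable_bounded_actionDeriv_dressed (u : PBond P 0 → Matrix (Fin N) (Fin N) ℂ) (lo hi : Fin P.d → ℤ) :
    Measurable (fun U : GaugeField P 0 (Matrix.specialUnitaryGroup (Fin N) ℂ) =>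
        actionDeriv (fundamentalRep (Fin N)) u (GaugeField.gaugeAct (axialGauge U lo hi) U)) ∧
      ∃ B : ℝ, 0 ≤ B ∧ ∀ U : GaugeField P 0 (Matrix.specialUnitaryGroup (Fin N) ℂ),
        |actionDeriv (fundamentalRep (Fin N)) u (GaugeField.gaugeAct (axialGauge U lo hi) U)| ≤ B := by
  haveI : SecondCountableTopology (Matrix.specialUnitaryGroup (Fin N) ℂ) := by
    haveI := secondCountableTopology_matrix (n := Fin N)
    exact Topology.IsEmbedding.subtypeVal.secondCountableTopology
  haveI : CompactSpace (GaugeField P 0 (Matrix.specialUnitaryGroup (Fin N) ℂ)) :=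
    inferInstanceAs (CompactSpace (PBond P 0 → Matrix.specialUnitaryGroup (Fin N) ℂ))
  haveI : OpensMeasurableSpace (GaugeField P 0 (Matrix.specialUnitaryGroup (Fin N) ℂ)) :=
    inferInstanceAs (OpensMeasurableSpace (PBond P 0 → Matrix.specialUnitaryGroup (Fin N) ℂ))
  have hc : Continuous fun W : GaugeField P 0 (Matrix.specialUnitaryGroup (Fin N) ℂ) => actionDeriv (fundamentalRep (Fin N)) u W :=
    continuous_actionDeriv (continuous_fundamentalRep (Fin N)) u
  obtain ⟨B, hB0, hB⟩ := exists_abs_le_of_continuous hc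
  exact ⟨hc.measurable.comp (measurable_gaugeAct_axialGauge lo hi), B, hB0, fun U => hB _⟩

/-- ★★ **THE INTEGRATED EVENT SPLIT, DRESSED ROWS** (`SU(N)`, any probability measure `μ` on the finest-lattice configurations, any finite family of test
fields `u α`, any box, constants `C, E ≥ 0`, any measurable event `G`, `0 ≤ f ≤ M`): a pointwise bound ON `G`
`f U ≤ C·Σ_α (actionDeriv ρ (u α) (V U))² + E`, `V U = U^{axialGauge U lo hi}`, integrates to
`∫ f dμ ≤ C·Σ_α ∫ (actionDeriv ρ (u α) (V U))² dμ + E + M·μ.real Gᶜ`. [cite: GrossCMP1983, Thm 2.2] -/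
theorem integral_le_of_pointwise_dressed {ι : Type*} [Fintype ι]
    (μ : Measure (GaugeField P 0 (Matrix.specialUnitaryGroup (Fin N) ℂ))) [IsProbabilityMeasure μ]
    {f : GaugeField P 0 (Matrix.specialUnitaryGroup (Fin N) ℂ) → ℝ} {M : ℝ} (hf0 : ∀ U, 0 ≤ f U) (hfM : ∀ U, f U ≤ M)
    {G : Set (GaugeField P 0 (Matrix.specialUnitaryGroup (Fin N) ℂ))} (hG : MeasurableSet G)
    (lo hi : Fin P.d → ℤ) (u : ι → PBond P 0 → Matrix (Fin N) (Fin N) ℂ) {C E : ℝ} (hC : 0 ≤ C) (hE : 0 ≤ E)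
    (hpt : ∀ U ∈ G, f U ≤ C * ∑ α, (actionDeriv (fundamentalRep (Fin N)) (u α) (GaugeField.gaugeAct (axialGauge U lo hi) U)) ^ 2 + E) :
    ∫ U, f U ∂μ ≤
      C * ∑ α, ∫ U, (actionDeriv (fundamentalRep (Fin N)) (u α) (GaugeField.gaugeAct (axialGauge U lo hi) U)) ^ 2 ∂μ
        + E + M * μ.real Gᶜ := by
  -- the rows are bounded measurable, hence integrable
  have hrow : ∀ α, Integrable (fun U => (actionDeriv (fundamentalRep (Fin N)) (u α)
      (GaugeField.gaugeAct (axialGauge U lo hi) U)) ^ 2) μ := fun α => by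
    obtain ⟨hm, B, hB0, hB⟩ := measurable_bounded_actionDeriv_dressed (P := P) (u α) lo hi
    refine integrable_of_abs_le μ (hm.pow_const 2) (C := B ^ 2) fun U => ?_
    rw [abs_pow]
    exact pow_le_pow_left₀ (abs_nonneg _) (hB U) 2
  set g : GaugeField P 0 (Matrix.specialUnitaryGroup (Fin N) ℂ) → ℝ := fun U =>
    C * ∑ α, (actionDeriv (fundamentalRep (Fin N)) (u α) (GaugeField.gaugeAct (axialGauge U lo hi) U)) ^ 2 + E with hg
  have hg0 : ∀ U, 0 ≤ g U := fun U =>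
    add_nonneg (mul_nonneg hC (Finset.sum_nonneg fun α _ => sq_nonneg _)) hE
  have hsum : Integrable (fun U => ∑ α, (actionDeriv (fundamentalRep (Fin N)) (u α)
      (GaugeField.gaugeAct (axialGauge U lo hi) U)) ^ 2) μ := integrable_finsetSum _ fun α _ => hrow α
  have hgi : Integrable g μ := (hsum.const_mul C).add (integrable_const E)
  have h := integral_le_of_onEvent_bound μ hf0 hfM hG hg0 hgi hpt
  have hgint : ∫ U, g U ∂μ =
      C * ∑ α, ∫ U, (actionDeriv (fundamentalRep (Fin N)) (u α) (GaugeField.gaugeAct (axialGauge U lo hi) U)) ^ 2 ∂μ + E := by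
    rw [hg, integral_add (hsum.const_mul C) (integrable_const E), integral_const_mul, integral_finsetSum _ (fun α _ => hrow α),
      integral_const, smul_eq_mul, probReal_univ, one_mul]
  linarith [h, hgint]

end SpecialUnitary

/-! ## §4 In the currency of `stub_linTest` -/

section Stub

/-- ★★★ **THE LAST THREE LINES OF `stub_linTest` FROM A POINTWISE BOUND.**  For `γ ≥ 0`, every `K, j`, every level-`j` plaquette `a`, box `(lo, hi)`,
threshold `θ`, test fields `u : Fin 3 → …` and constants `C, E ≥ 0`: IF on the small-field event `PlaqSmallOn (boxPlaqs lo hi) θ U` the block plaquette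
deviation obeys POINTWISE `dist₁(Ū^j(∂a))² ≤ C·Σ_α (actionDeriv ρ (u α) (U^{axialGauge U lo hi}))² + E`, THEN
`∫ dist₁(Ū^j(∂a))² d gibbsK ≤ C·Σ_α ∫ (actionDeriv ρ (u α) (U^{axialGauge U lo hi}))² d gibbsK + E + 4·gibbsK{¬ PlaqSmallOn (boxPlaqs lo hi) θ}` —
the stub's display with `E := C·γ·L^{−(K−j)}` and `θ := (γL^{−K})^{3/8}` (`dist₁ ≤ 2` off the event; `gibbsK` is a probability measure).  By §1 the pointwise
hypothesis may equivalently be proved for the DRESSED field's own block plaquette (`j ≤ m + K`). [cite: GrossCMP1983, Thm 2.2; Balaban1985Averaging, (11) p.19] -/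
theorem integral_dist1_sq_iter_le_of_pointwise (F : T3Family) {γ : ℝ} (hγ : 0 ≤ γ) (K j : ℕ) (a : Plaq (F.P K) j)
    (lo hi : Fin (F.P K).d → ℤ) (θ : ℝ) (u : Fin 3 → PBond (F.P K) 0 → Matrix (Fin 2) (Fin 2) ℂ) {C E : ℝ} (hC : 0 ≤ C) (hE : 0 ≤ E)
    (hpt : ∀ U : GaugeField (F.P K) 0 (Matrix.specialUnitaryGroup (Fin 2) ℂ), PlaqSmallOn (boxPlaqs lo hi) θ U →
      (GaugeGroup.dist1 (GaugeField.plaqHol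
          (Averaging.iter (fun i' => BlockAveraging.blockAvg (P := F.P K) (j := i') ℰp) j U) a)) ^ 2
        ≤ C * ∑ α, (actionDeriv (fundamentalRep (Fin 2)) (u α) (GaugeField.gaugeAct (axialGauge U lo hi) U)) ^ 2 + E) :
    ∫ U, (GaugeGroup.dist1 (GaugeField.plaqHol
        (Averaging.iter (fun i' => BlockAveraging.blockAvg (P := F.P K) (j := i') ℰp) j U) a)) ^ 2 ∂(gibbsK F ℰp γ K)
      ≤ C * ∑ α, ∫ U, (actionDeriv (fundamentalRep (Fin 2)) (u α) (GaugeField.gaugeAct (axialGauge U lo hi) U)) ^ 2 ∂(gibbsK F ℰp γ K)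
        + E
        + 4 * (gibbsK F ℰp γ K).real {U | ¬ PlaqSmallOn (boxPlaqs lo hi) θ U} := by
  haveI := isProbabilityMeasure_gibbsK F ℰp hγ K
  have hG : MeasurableSet {U : GaugeField (F.P K) 0 (Matrix.specialUnitaryGroup (Fin 2) ℂ) | PlaqSmallOn (boxPlaqs lo hi) θ U} :=
    measurableSet_plaqSmallOn _ _
  have hf0 : ∀ U : GaugeField (F.P K) 0 (Matrix.specialUnitaryGroup (Fin 2) ℂ), 0 ≤ (GaugeGroup.dist1 (GaugeField.plaqHol
      (Averaging.iter (fun i' => BlockAveraging.blockAvg (P := F.P K) (j := i') ℰp) j U) a)) ^ 2 := fun U => sq_nonneg _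
  have hf4 : ∀ U : GaugeField (F.P K) 0 (Matrix.specialUnitaryGroup (Fin 2) ℂ), (GaugeGroup.dist1 (GaugeField.plaqHol
      (Averaging.iter (fun i' => BlockAveraging.blockAvg (P := F.P K) (j := i') ℰp) j U) a)) ^ 2 ≤ 4 := fun U => by
    have h2 := T4PairDerivBridge.dist1_le_two_specialUnitaryGroup (GaugeField.plaqHol
      (Averaging.iter (fun i' => BlockAveraging.blockAvg (P := F.P K) (j := i') ℰp) j U) a)
    have h0 := GaugeGroup.dist1_nonneg (GaugeField.plaqHol
      (Averaging.iter (fun i' => BlockAveraging.blockAvg (P := F.P K) (j := i') ℰp) j U) a)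
    nlinarith
  have h := integral_le_of_pointwise_dressed (gibbsK F ℰp γ K) hf0 hf4 hG lo hi u hC hE (fun U hU => hpt U hU)
  have hc : {U : GaugeField (F.P K) 0 (Matrix.specialUnitaryGroup (Fin 2) ℂ) | PlaqSmallOn (boxPlaqs lo hi) θ U}ᶜ =
      {U | ¬ PlaqSmallOn (boxPlaqs lo hi) θ U} := rfl
  rw [hc] at h
  exact h

end Stub

end Summit.QuantumFields.YangMills.Theorems.UnitScaleGibbsDressedEventSplit

end
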